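import Summits.QuantumFields.YangMills.Theorems.InfiniteVolumeTorusScheme
import HarnessLib

/-!
# Infinite volume by compactness, step 6′: the (A)↔(B) junction along PRESCRIBED defining torus sequences

Seat `ym-infvol-p1` (R136 (i), route `InfiniteVolumeContinuum`; companion to seat p2's step 6
`Theorems/InfiniteVolumeTorusScheme.lean`).  HONEST FRAMING: pure soft analysis, kernel-checked; the spine's UV-leg
currency `MomentBounds6 G r a` is a HYPOTHESIS; nothing here is a statement about Bałaban's renormalisation group,
the OS axioms, uniqueness of the infinite-volume state, a mass gap, or Clay.

WHY.  Seat p2's junction `exists_torusSides_approximating` takes states `μ_k ∈ oddTorusLimitPoints r (β_k)` and CHOOSES,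
inside the proof, one defining odd-torus sequence per state; its output only records that each approximating half-side
`L_k` lies in the range of SOME defining sequence.  The class-local rotation leg of the spine's crux `ROT` rev 2′
(`Theorems.ROT.LatticeRotWardOn G r a S`: Ward identities only along schemes whose torus half-sides lie in a class `S`,
route owner's R85 batch, 2026-08-26) needs the approximating tori INSIDE a prescribed class.  THIS FILE: the same
theorem with the defining sequences `N k` as INPUT — then `L_k ∈ range (N k)`, hence in any class containing the
`N k j`.  The proof is p2's, verbatim, minus the choice.

* `exists_torusSides_approximating_along` — thresholds `β₀`, `ℓ₀ > 0` from `MomentBounds6`; for every admissible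
  coupling sequence, every family of states with GIVEN defining odd-torus sequences, every growth demand: half-sides
  `L_k ∈ range (N k)` above the demand (and `≥ 14`, `≥ a_k⁻²`) with
  `latticeDistStr(β_k, L_k, a_k)(q)(F) − Σ'ₓ W_{μ_k}(q,x)·F(a_k·x) → 0` for every `n ≥ 2`, valid `q`, `F ∈ ⁰𝒮ₙ`.

References: Glimm–Jaffe (1987) §6.1; Osterwalder–Schrader CMP 42 (1975) §2; Chatterjee arXiv:1803.01950 §2.
-/

set_option autoImplicit false

noncomputable section

open scoped BigOperators SchwartzMap
open MeasureTheory Filter Topology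
open Literature.MathematicalPhysics.QuantumFieldTheory hiding ZdEdge
open Literature.MathematicalPhysics.QuantumLattice
open Literature.MathematicalPhysics.AQFT
open Literature.Probability.LatticeModels (box Site)
open Summit.QuantumFields.YangMills.Cruxes.OSLegsFromFemtoAndGap.DlrCollarTransfer
  (plane torusE MomentBounds6 exists_abs_plane_le)
open Summit.QuantumFields.YangMills.Theorems.OSLegsFromFemtoAndGap
  (torusMomentStr latticeDistStr latticeDistStr_apply norm_latticeSumStr_plane_le seminorm_budget_le_schwartzNorm
    schwartz_exists_countable_seminorm_dense)

namespace Summit.QuantumFields.YangMills.Theorems.InfiniteVolume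

variable {G : Type} [Group G] [TopologicalSpace G] [IsTopologicalGroup G] [CompactSpace G]
  [MeasurableSpace G] [BorelSpace G]

/-! ## The junction theorem along prescribed sequences -/

/-- **Seat p2's junction with the defining sequences as input.**  From `MomentBounds6 G r a`: thresholds `β₀`,
`ℓ₀ > 0` such that for every coupling sequence `β_k ≥ β₀` with `0 < a(β_k) ≤ 1/24`, `a(β_k) ≤ ℓ₀`, every family of
states `μ_k` that are infinite-volume limits ALONG given strictly increasing odd-torus sequences `2·N k j + 1`, and every
growth demand `g`, there are torus half-sides `L_k ∈ range (N k)` with `g k ≤ L_k`, `14 ≤ L_k`, `a(β_k)⁻² ≤ L_k` such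
that for every `n ≥ 2`, valid string `q` and `F ∈ ⁰𝒮ₙ` the spine's torus string functional at `(β_k, L_k, a(β_k))`
minus the base-point infinite-volume series of `μ_k` tends to `0`.  (Verbatim the proof of
`InfiniteVolume.exists_torusSides_approximating`, without choosing the sequences.) [folklore] -/
theorem exists_torusSides_approximating_along (r : LatticeRep G) {a : ℝ → ℝ} (hMB : MomentBounds6 G r a) :
    ∃ (β₀ ℓ₀ : ℝ), 0 < ℓ₀ ∧
      ∀ (β : ℕ → ℝ), (∀ k, β₀ ≤ β k) → (∀ k, 0 < a (β k)) → (∀ k, a (β k) ≤ 1 / 24) → (∀ k, a (β k) ≤ ℓ₀) →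
      ∀ (μ : ℕ → Measure (LGConfig 4 G)) (N : ℕ → ℕ → ℕ), (∀ k, StrictMono (N k)) →
        (∀ k, IsInfiniteVolumeLimitAlong (d := 4) r.ρ (β k) (fun j => 2 * N k j) (μ k)) →
      ∀ g : ℕ → ℕ, ∃ L : ℕ → ℕ, (∀ k, g k ≤ L k) ∧ (∀ k, 14 ≤ L k ∧ (a (β k))⁻¹ * (a (β k))⁻¹ ≤ (L k : ℝ)) ∧
        (∀ k, L k ∈ Set.range (N k)) ∧
        ∀ n : ℕ, 2 ≤ n → ∀ q : Fin n → Fin 4 × Fin 4, (∀ i, (q i).1 < (q i).2) →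
          ∀ F : 𝓢((Fin n → EuclideanSpace ℝ (Fin 4)), ℂ), IsOffDiagonal F →
            Tendsto (fun k => latticeDistStr r.ρ (β k) (L k) (a (β k)) (fun i U => plaquetteObs r.ρ 0 (q i).1 (q i).2 U)
                (fun i => wilsonTorusMean r.ρ (β k) (L k) (fun U => plaquetteObs r.ρ 0 (q i).1 (q i).2 U)) F -
              ∑' x : Fin n → Site 4,
                (((∫ U, ∏ i, (plane G r (q i) (x i) U - ∫ V, plane G r (q i) (x i) V ∂(μ k)) ∂(μ k) : ℝ) : ℂ)) *
                  F (fun l => a (β k) • siteToE (x l))) atTop (𝓝 0) := by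
  classical
  -- constants: infinite-volume side and torus side (the spine)
  obtain ⟨C, β₄, ℓ₄, hℓ, hC, Hcol⟩ := hMB
  obtain ⟨β₄', ℓ₄', KT, hℓ', hKT, HT⟩ := norm_latticeDistStr_le_of_momentBounds6 r ⟨C, β₄, ℓ₄, hℓ, hC, Hcol⟩
  obtain ⟨Cp, hCp⟩ := exists_abs_plane_le (G := G) r
  have hCp0 : 0 ≤ Cp := le_trans (abs_nonneg _) (hCp (0, 1) 0 (fun _ => 1))
  set KI : ℝ := ((Cp + Cp) * 4 ^ 4 * 5 ^ 6 + (Cp + Cp) * 2 ^ 6 * (10 + 2 * 6) ^ 4 +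
      16 * C * 2 ^ 6 * (2 / ℓ₄ + 48) ^ 4) * 2 ^ 6 * (81 * ∑' m : ℕ, (((m : ℝ) + 1) ^ 2)⁻¹) with hKI
  have hKI0 : 0 ≤ KI := by
    have : 0 ≤ ∑' m : ℕ, (((m : ℝ) + 1) ^ 2)⁻¹ := tsum_nonneg fun m => by positivity
    positivity
  refine ⟨max β₄ β₄', min ℓ₄ ℓ₄', lt_min hℓ hℓ', ?_⟩
  intro β hβ ha ha24 haℓ μ S hS hlim g
  have hβ₁ : ∀ k, β₄ ≤ β k := fun k => le_trans (le_max_left _ _) (hβ k)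
  have hβ₂ : ∀ k, β₄' ≤ β k := fun k => le_trans (le_max_right _ _) (hβ k)
  have hℓ₁ : ∀ k, a (β k) ≤ ℓ₄ := fun k => (haℓ k).trans (min_le_left _ _)
  have hℓ₂ : ∀ k, a (β k) ≤ ℓ₄' := fun k => (haℓ k).trans (min_le_right _ _)
  have ha1 : ∀ k, a (β k) ≤ 1 := fun k => (ha24 k).trans (by norm_num)
  have hsa : ∀ k, (0 : ℝ) * a (β k) ≤ 1 / 4 := fun k => by simp
  haveI : ∀ k, IsProbabilityMeasure (μ k) := fun k => (hlim k).1
  have hμ : ∀ k, μ k ∈ oddTorusLimitPoints r (β k) := fun k => ⟨S k, hS k, hlim k⟩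
  -- countable dense subsets of the `⁰𝒮ₙ`
  have hD := fun n : ℕ => schwartz_exists_countable_seminorm_dense (X := Fin n → EuclideanSpace ℝ (Fin 4)) (10 * n)
    {F : 𝓢((Fin n → EuclideanSpace ℝ (Fin 4)), ℂ) | IsOffDiagonal F}
  choose D hDA hDc hDd using hD
  haveI : ∀ n, Countable (D n) := fun n => (hDc n).to_subtype
  -- the countable family of (arity, string, dense test function) and the diagonal selection
  let ι := Σ n : ℕ, (Fin n → Fin 4 × Fin 4) × (D n)
  let u : ℕ → ι → ℕ → ℂ := fun k i m =>
    latticeDistStr r.ρ (β k) (S k m) (a (β k)) (fun l U => plaquetteObs r.ρ 0 (i.2.1 l).1 (i.2.1 l).2 U)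
      (fun l => wilsonTorusMean r.ρ (β k) (S k m) (fun U => plaquetteObs r.ρ 0 (i.2.1 l).1 (i.2.1 l).2 U)) i.2.2.1
  let c : ℕ → ι → ℂ := fun k i => ∑' x : Fin i.1 → Site 4,
    (((∫ U, ∏ l, (plane G r (i.2.1 l) (x l) U - ∫ V, plane G r (i.2.1 l) (x l) V ∂(μ k)) ∂(μ k) : ℝ) : ℂ)) *
      (i.2.2.1 : 𝓢((Fin i.1 → EuclideanSpace ℝ (Fin 4)), ℂ)) (fun l => a (β k) • siteToE (x l))
  have hu : ∀ k i, Tendsto (fun m => u k i m) atTop (𝓝 (c k i)) := fun k i =>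
    tendsto_latticeDistStr_tsum r (hS k) (hlim k) (ha k) (ha1 k) i.2.1 i.2.2.1
  -- growth demand including the thresholds of the torus bound
  obtain ⟨Ld, hLdg, hLd⟩ := exists_growth_diagonal u c hu
    (fun k => max (g k) (max 14 ⌈(a (β k))⁻¹ * (a (β k))⁻¹⌉₊))
  refine ⟨fun k => S k (Ld k), fun k => ?_, fun k => ⟨?_, ?_⟩, fun k => ⟨Ld k, rfl⟩, ?_⟩
  · exact le_trans (le_trans (le_max_left _ _) (hLdg k)) ((hS k).id_le _)
  · exact le_trans (le_trans (le_trans (le_max_left _ _) (le_max_right _ _)) (hLdg k)) ((hS k).id_le _)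
  · have h1 : ((⌈(a (β k))⁻¹ * (a (β k))⁻¹⌉₊ : ℕ) : ℝ) ≤ S k (Ld k) := by
      exact_mod_cast le_trans (le_trans (le_trans (le_max_right _ _) (le_max_right _ _)) (hLdg k)) ((hS k).id_le _)
    exact (Nat.le_ceil _).trans h1
  intro n hn q hq F hF
  have hL14 : ∀ k, 14 ≤ S k (Ld k) := fun k =>
    le_trans (le_trans (le_trans (le_max_left _ _) (le_max_right _ _)) (hLdg k)) ((hS k).id_le _)
  have hLa : ∀ k, (a (β k))⁻¹ * (a (β k))⁻¹ ≤ (S k (Ld k) : ℝ) := fun k => by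
    have h1 : ((⌈(a (β k))⁻¹ * (a (β k))⁻¹⌉₊ : ℕ) : ℝ) ≤ S k (Ld k) := by
      exact_mod_cast le_trans (le_trans (le_trans (le_max_right _ _) (le_max_right _ _)) (hLdg k)) ((hS k).id_le _)
    exact (Nat.le_ceil _).trans h1
  -- shorthand for the two functionals at level `k`
  set T : ℕ → 𝓢((Fin n → EuclideanSpace ℝ (Fin 4)), ℂ) → ℂ := fun k F' =>
    latticeDistStr r.ρ (β k) (S k (Ld k)) (a (β k)) (fun i U => plaquetteObs r.ρ 0 (q i).1 (q i).2 U)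
      (fun i => wilsonTorusMean r.ρ (β k) (S k (Ld k)) (fun U => plaquetteObs r.ρ 0 (q i).1 (q i).2 U)) F' with hTdef
  set W : ℕ → (Fin n → Site 4) → ℝ := fun k x =>
    ∫ U, ∏ i, (plane G r (q i) (x i) U - ∫ V, plane G r (q i) (x i) V ∂(μ k)) ∂(μ k) with hWdef
  set Λ : ℕ → 𝓢((Fin n → EuclideanSpace ℝ (Fin 4)), ℂ) → ℂ := fun k F' =>
    ∑' x : Fin n → Site 4, ((W k x : ℝ) : ℂ) * F' (fun l => a (β k) • siteToE (x l)) with hΛdef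
  have hWsup : ∀ k x, |W k x| ≤ (Cp + Cp) ^ n := fun k x => abs_infVolWeight_le r hCp (μ k) q x
  have hWcol : ∀ k (x : Fin n → Site 4) (R : ℕ), 1 ≤ R → (R : ℝ) * a (β k) ≤ ℓ₄ →
      (∀ i j : Fin n, i ≠ j → ∃ m : Fin 4, (2 * (R : ℤ) + 4) ≤ |x i m - x j m|) →
      |W k x| ≤ (C / (R : ℝ) ^ 4) ^ n := fun k x R hR hRa hsep =>
    momentBounds6_oddTorusLimitPoints r Hcol (hβ₁ k) ⟨S k, hS k, hlim k⟩ q x R hq hR hRa hsep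
  have hy0 : ∀ k (x : Fin n → Site 4) l, ‖(fun l => a (β k) • siteToE (x l)) l - a (β k) • siteToE (x l)‖ ≤
      0 * a (β k) := fun k x l => by simp
  have hy6 : ∀ k (x : Fin n → Site 4) l, ‖(fun l => a (β k) • siteToE (x l)) l - a (β k) • siteToE (x l)‖ ≤
      6 * a (β k) := fun k x l => by rw [sub_self, norm_zero]; exact mul_nonneg (by norm_num) (ha k).le
  -- the two a-uniform bounds on `⁰𝒮ₙ`
  have hTb : ∀ k (F' : 𝓢((Fin n → EuclideanSpace ℝ (Fin 4)), ℂ)), IsOffDiagonal F' →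
      ‖T k F'‖ ≤ 5 * KT ^ n * schwartzNorm (10 * n) F' := fun k F' hF' =>
    HT (β k) (hβ₂ k) (ha k) (ha24 k) (hℓ₂ k) (S k (Ld k)) (hL14 k) (hLa k) n hn q hq F' hF'
  have hΛb : ∀ k (F' : 𝓢((Fin n → EuclideanSpace ℝ (Fin 4)), ℂ)), IsOffDiagonal F' →
      ‖Λ k F'‖ ≤ 5 * KI ^ n * schwartzNorm (10 * n) F' := fun k F' hF' =>
    norm_tsum_weight_mul_le hℓ hC (by positivity : 0 ≤ Cp + Cp) (W k) (hWsup k) (hWcol k) (ha k) (ha1 k)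
      (hℓ₁ k) hn (by norm_num) le_rfl (by linarith [ha24 k]) F' hF' _ (hy6 k)
  -- linearity
  have hTsub : ∀ k (F' F'' : 𝓢((Fin n → EuclideanSpace ℝ (Fin 4)), ℂ)), T k (F' - F'') = T k F' - T k F'' :=
    fun k F' F'' => by simp only [hTdef, map_sub]
  have hΛsub : ∀ k (F' F'' : 𝓢((Fin n → EuclideanSpace ℝ (Fin 4)), ℂ)), Λ k (F' - F'') = Λ k F' - Λ k F'' :=
    fun k F' F'' => tsum_weight_mul_sub (ha k) (ha1 k) (hsa k) (pow_nonneg (by positivity) n) (W k) (hWsup k) _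
      (hy0 k) F' F''
  -- convergence on the dense set, then everywhere on `⁰𝒮ₙ` by `ε/3`
  have hdense : ∀ d ∈ D n, Tendsto (fun k => T k d - Λ k d) atTop (𝓝 0) := fun d hd =>
    tendsto_sub_diagonal hLd ⟨n, q, ⟨d, hd⟩⟩
  rw [NormedAddGroup.tendsto_nhds_zero]
  intro ε hε
  have hden : 0 < 5 * KT ^ n + 5 * KI ^ n + 1 := by positivity
  obtain ⟨d, hd, hdε⟩ := hDd n F hF (ε / (2 * (5 * KT ^ n + 5 * KI ^ n + 1))) (by positivity)
  have hdD : IsOffDiagonal d := hDA n hd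
  have hsmall := (NormedAddGroup.tendsto_nhds_zero.1 (hdense d hd)) (ε / 2) (by positivity)
  filter_upwards [hsmall] with k hk
  have h1 : T k F - Λ k F = (T k (F - d) - Λ k (F - d)) + (T k d - Λ k d) := by
    rw [hTsub, hΛsub]; ring
  rw [h1]
  have h2 : ‖T k (F - d) - Λ k (F - d)‖ ≤ (5 * KT ^ n + 5 * KI ^ n) * schwartzNorm (10 * n) (F - d) := by
    calc _ ≤ ‖T k (F - d)‖ + ‖Λ k (F - d)‖ := norm_sub_le _ _
      _ ≤ 5 * KT ^ n * schwartzNorm (10 * n) (F - d) + 5 * KI ^ n * schwartzNorm (10 * n) (F - d) :=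
          add_le_add (hTb k _ (hF.sub hdD)) (hΛb k _ (hF.sub hdD))
      _ = _ := by ring
  have h3 : (5 * KT ^ n + 5 * KI ^ n) * schwartzNorm (10 * n) (F - d) < ε / 2 := by
    have hq' : (5 * KT ^ n + 5 * KI ^ n) * schwartzNorm (10 * n) (F - d) ≤
        (5 * KT ^ n + 5 * KI ^ n + 1) * schwartzNorm (10 * n) (F - d) :=
      mul_le_mul_of_nonneg_right (by linarith) (schwartzNorm_nonneg _ _)
    have hq'' : (5 * KT ^ n + 5 * KI ^ n + 1) * schwartzNorm (10 * n) (F - d) <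
        (5 * KT ^ n + 5 * KI ^ n + 1) * (ε / (2 * (5 * KT ^ n + 5 * KI ^ n + 1))) :=
      mul_lt_mul_of_pos_left hdε hden
    have hq''' : (5 * KT ^ n + 5 * KI ^ n + 1) * (ε / (2 * (5 * KT ^ n + 5 * KI ^ n + 1))) = ε / 2 := by
      field_simp
    linarith
  calc ‖T k (F - d) - Λ k (F - d) + (T k d - Λ k d)‖
      ≤ ‖T k (F - d) - Λ k (F - d)‖ + ‖T k d - Λ k d‖ := norm_add_le _ _
    _ < ε / 2 + ε / 2 := add_lt_add (lt_of_le_of_lt h2 h3) hk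
    _ = ε := by ring

end Summit.QuantumFields.YangMills.Theorems.InfiniteVolume

end
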